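import Literature.Probability.RandomMatrixProducts.AndersonModel1DSmoothing
import Mathlib.MeasureTheory.Integral.Prod
import Mathlib.MeasureTheory.Integral.DominatedConvergence
import Mathlib.Analysis.SpecialFunctions.Log.Basic
import Mathlib.Topology.Order.Compact
import HarnessLib

/-!
# Continuity of the Lyapunov exponent of the Anderson model, I: finite-volume estimates

Companion to `AndersonModel1D.lean` (Bucaj–Damanik–Fillman–Gerbuz–VandenBoom–Wang–Zhang,
*Localization for the one-dimensional Anderson model via positivity and large deviations for the
Lyapunov exponent*, TAMS **372** (2019) 3619–3667, arXiv:1706.06135, §2).  Everything here is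
PROVED; this is the first of the files discharging the named fact
`BucajEtAl2019_lyapunovContinuous` (Thm 2.6 there: `E ↦ L(E)` is continuous), whose printed proof
rests on the Fürstenberg–Kifer theorem (Thm 2.5 there).  The elementary, finite-volume half of the
argument is collected here (single-site law `μ` with `|x| ≤ R` a.s., transfer matrices
`M^E(α) = [[E - α, -1],[1, 0]]`, `M_n = M(α_{n-1}) ⋯ M(α_0)`, `a_n(E) = 𝔼 log ‖M_n^E‖`,
`g_n^E(v) = 𝔼 log ‖M_n^E v‖`):

* joint continuity of `(E, α, v) ↦ M_n^E(α) v`, two-sided bounds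
  `|log ‖M_n^E v‖| ≤ n log(|E|+R+1)` on the support box, integrability;
* `E ↦ a_n(E)` is continuous (dominated convergence), hence **upper semicontinuity** of
  `L(E) = inf_n a_n(E)/n` (`andersonLyapunov_lt_add_nhds`);
* `(E, v) ↦ g_n^E(v)` is continuous on `ℝ × 𝕊¹`;
* splitting off the first site (`Fin.cons`) and homogeneity `g_n(c u) = log c + g_n(u)`;
* **sub-additivity** `a_{p+q} ≤ a_p + a_q` and **super-additivity**
  `g_{p+q}(v) ≥ g_p(v) + inf_w g_q(w)` (independence of blocks), whence
  `inf_{‖v‖=1} g_n^E(v) ≤ n L(E)` for every `n ≥ 1`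
  (`iInf_integral_log_norm_apply_div_le_andersonLyapunov`) — the inequality through which a
  uniform lower bound on vector growth at ONE scale `n` propagates to the Lyapunov exponent of all
  nearby energies (lower semicontinuity, in the sequel).

Not here: stationary measures on the circle and the Fürstenberg–Kifer invariance
`∫∫ log ‖M(a) w‖ dμ(a) dm(w) = L` for every stationary `m` (the sequel).
-/

noncomputable section

open MeasureTheory Filter Set Topology
open scoped Matrix.Norms.L2Operator Matrix ENNReal

namespace Literature.Probability.RandomMatrixProducts

/-! ### Joint continuity in the energy and the sample -/

/-- `(E, α) ↦ M_k^E(α)` is continuous (its entries are polynomials). [folklore] -/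
theorem continuous_andersonTransferProd_param {n : ℕ} :
    ∀ k, Continuous fun p : ℝ × (Fin n → ℝ) => andersonTransferProd p.1 (padSeq p.2) k
  | 0 => by simpa using continuous_const
  | k + 1 => by
    simp only [andersonTransferProd_succ]
    refine Continuous.mul ?_ (continuous_andersonTransferProd_param k)
    have hc : Continuous fun p : ℝ × (Fin n → ℝ) => padSeq p.2 k := by
      unfold padSeq
      split_ifs with h
      · exact (continuous_apply _).comp continuous_snd
      · exact continuous_const
    refine continuous_matrix fun i j => ?_
    fin_cases i <;> fin_cases j <;> simp [andersonTransfer] <;> fun_prop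

/-- `E ↦ M_k^E(α)` is continuous. [folklore] -/
theorem continuous_andersonTransferProd_energy {n : ℕ} (x : Fin n → ℝ) (k : ℕ) :
    Continuous fun E : ℝ => andersonTransferProd E (padSeq x) k :=
  (continuous_andersonTransferProd_param (n := n) k).comp (Continuous.prodMk_left x)

/-- `((E, α), v) ↦ M_k^E(α) v` is continuous. [folklore] -/
theorem continuous_andersonTransferProd_param_apply {n : ℕ} (k : ℕ) :
    Continuous fun p : (ℝ × (Fin n → ℝ)) × EuclideanSpace ℝ (Fin 2) =>
      Matrix.toEuclideanLin (andersonTransferProd p.1.1 (padSeq p.1.2) k) p.2 := by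
  have hM := continuous_andersonTransferProd_param (n := n) k
  show Continuous fun p : (ℝ × (Fin n → ℝ)) × EuclideanSpace ℝ (Fin 2) =>
    WithLp.toLp 2 ((andersonTransferProd p.1.1 (padSeq p.1.2) k) *ᵥ (p.2).ofLp)
  refine (PiLp.continuous_toLp 2 _).comp ?_
  refine continuous_pi fun i => ?_
  simp only [Matrix.mulVec, dotProduct, Fin.sum_univ_two]
  have h1 : ∀ i j, Continuous fun p : (ℝ × (Fin n → ℝ)) × EuclideanSpace ℝ (Fin 2) =>
      andersonTransferProd p.1.1 (padSeq p.1.2) k i j :=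
    fun i j => (continuous_apply j).comp ((continuous_apply i).comp (hM.comp continuous_fst))
  have h2 : ∀ j, Continuous fun p : (ℝ × (Fin n → ℝ)) × EuclideanSpace ℝ (Fin 2) => (p.2).ofLp j :=
    fun j => (continuous_apply j).comp ((PiLp.continuous_ofLp 2 _).comp continuous_snd)
  exact ((h1 i 0).mul (h2 0)).add ((h1 i 1).mul (h2 1))

/-! ### Non-vanishing and two-sided bounds -/

/-- A matrix of determinant `1` does not kill non-zero vectors. [folklore] -/
theorem toEuclideanLin_ne_zero_of_det (X : Matrix (Fin 2) (Fin 2) ℝ) (hX : X.det = 1)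
    {v : EuclideanSpace ℝ (Fin 2)} (hv : v ≠ 0) : Matrix.toEuclideanLin X v ≠ 0 := by
  intro h0
  have hv' : v.ofLp ≠ 0 := fun h => hv (by
    apply PiLp.ext; intro i; have := congrFun h i; simpa using this)
  have hmul : X *ᵥ v.ofLp = 0 := congrArg WithLp.ofLp h0
  have : X.det = 0 := Matrix.exists_mulVec_eq_zero_iff.mp ⟨v.ofLp, hv', hmul⟩
  rw [hX] at this
  exact one_ne_zero this

/-- On the support box, `|log ‖M_n^E‖| ≤ n log(|E|+R+1)`. [folklore] -/
theorem abs_log_norm_transferProd_le {n : ℕ} {x : Fin n → ℝ} {R : ℝ} (hR : 0 ≤ R)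
    (hx : ∀ i, |x i| ≤ R) (E : ℝ) :
    |Real.log ‖andersonTransferProd E (padSeq x) n‖| ≤ n * Real.log (|E| + R + 1) := by
  have hD : 0 ≤ |E| + R := by positivity
  have hup := norm_andersonTransferProd_le E hD (padSeq x) n (abs_sub_padSeq_le hx E)
  have h1 := one_le_norm_of_det_eq_one _ (det_andersonTransferProd E (padSeq x) n)
  rw [abs_of_nonneg (Real.log_nonneg h1), ← Real.log_pow]
  exact Real.log_le_log (by positivity) hup

/-- On the support box, `|log ‖M_n^E v‖ - log ‖v‖| ≤ n log(|E|+R+1)` for `v ≠ 0`. [folklore] -/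
theorem abs_log_norm_transferProd_apply_sub_le {n : ℕ} {x : Fin n → ℝ} {R : ℝ} (hR : 0 ≤ R)
    (hx : ∀ i, |x i| ≤ R) (E : ℝ) {v : EuclideanSpace ℝ (Fin 2)} (hv : v ≠ 0) :
    |Real.log ‖Matrix.toEuclideanLin (andersonTransferProd E (padSeq x) n) v‖ - Real.log ‖v‖| ≤
      n * Real.log (|E| + R + 1) := by
  have hD : 0 ≤ |E| + R := by positivity
  obtain ⟨hup, hlow⟩ := norm_andersonTransferProd_apply_bounds E hD (padSeq x) v n
    (abs_sub_padSeq_le hx E)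
  have hvpos : 0 < ‖v‖ := norm_pos_iff.mpr hv
  have hMpos := norm_pos_iff.mpr (toEuclideanLin_ne_zero_of_det _ (det_andersonTransferProd E (padSeq x) n) hv)
  have hC : 0 < (|E| + R + 1) ^ n := by positivity
  rw [← Real.log_div hMpos.ne' hvpos.ne', abs_le, ← Real.log_pow]
  constructor
  · rw [← Real.log_inv]
    apply Real.log_le_log (by positivity)
    rw [le_div_iff₀ hvpos, inv_mul_eq_div, div_le_iff₀ hC]
    linarith
  · apply Real.log_le_log (by positivity)
    rw [div_le_iff₀ hvpos]
    linarith

/-- On the support box, `|log ‖M_n^E v‖| ≤ n log(|E|+R+1)` for a unit vector `v`. [folklore] -/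
theorem abs_log_norm_transferProd_apply_le {n : ℕ} {x : Fin n → ℝ} {R : ℝ} (hR : 0 ≤ R)
    (hx : ∀ i, |x i| ≤ R) (E : ℝ) {v : EuclideanSpace ℝ (Fin 2)} (hv : ‖v‖ = 1) :
    |Real.log ‖Matrix.toEuclideanLin (andersonTransferProd E (padSeq x) n) v‖| ≤
      n * Real.log (|E| + R + 1) := by
  have hv0 : v ≠ 0 := by
    intro h; rw [h, norm_zero] at hv; exact zero_ne_one hv
  simpa [hv] using abs_log_norm_transferProd_apply_sub_le hR hx E hv0

/-- A compactly supported law is a.s. bounded: `|x| ≤ R` a.e. for some `R ≥ 0`. [folklore] -/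
theorem exists_ae_abs_le_of_isCompact_support (μ : Measure ℝ) (hK : IsCompact μ.support) :
    ∃ R : ℝ, 0 ≤ R ∧ (∀ x ∈ μ.support, |x| ≤ R) ∧ ∀ᵐ x ∂μ, |x| ≤ R := by
  obtain ⟨r, hr⟩ := hK.isBounded.subset_closedBall 0
  refine ⟨max r 0, le_max_right _ _, fun x hx => ?_, ?_⟩
  · have := hr hx
    rw [Metric.mem_closedBall, dist_zero_right, Real.norm_eq_abs] at this
    exact this.trans (le_max_left _ _)
  · filter_upwards [Measure.support_mem_ae] with x hx
    have := hr hx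
    rw [Metric.mem_closedBall, dist_zero_right, Real.norm_eq_abs] at this
    exact this.trans (le_max_left _ _)

/-! ### Measurability and integrability of the log-norms -/

/-- `x ↦ log ‖M_n^E(x)‖` is measurable. [folklore] -/
theorem measurable_log_norm_transferProd (E : ℝ) (n k : ℕ) :
    Measurable fun x : Fin n → ℝ => Real.log ‖andersonTransferProd E (padSeq x) k‖ :=
  (continuous_andersonTransferProd E (n := n) k).norm.measurable.log

/-- `x ↦ log ‖M_n^E(x) v‖` is measurable. [folklore] -/
theorem measurable_log_norm_transferProd_apply (E : ℝ) (n k : ℕ) (v : EuclideanSpace ℝ (Fin 2)) :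
    Measurable fun x : Fin n → ℝ =>
      Real.log ‖Matrix.toEuclideanLin (andersonTransferProd E (padSeq x) k) v‖ :=
  (measurable_norm_andersonTransferProd_apply E k v).log

/-- `log ‖M_n^E‖` is integrable under the i.i.d. law of a bounded potential. [folklore] -/
theorem integrable_log_norm_transferProd (μ : Measure ℝ) [IsProbabilityMeasure μ] {R : ℝ}
    (hR0 : 0 ≤ R) (hR : ∀ᵐ x ∂μ, |x| ≤ R) (E : ℝ) (n : ℕ) :
    Integrable (fun x : Fin n → ℝ => Real.log ‖andersonTransferProd E (padSeq x) n‖)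
      (Measure.pi fun _ : Fin n => μ) := by
  refine Integrable.of_bound (measurable_log_norm_transferProd E n n).aestronglyMeasurable
    (n * Real.log (|E| + R + 1)) ?_
  filter_upwards [ae_pi_abs_le hR n] with x hx
  rw [Real.norm_eq_abs]
  exact abs_log_norm_transferProd_le hR0 hx E

/-- `log ‖M_n^E v‖` (`v ≠ 0`) is integrable under the i.i.d. law of a bounded potential. [folklore] -/
theorem integrable_log_norm_transferProd_apply (μ : Measure ℝ) [IsProbabilityMeasure μ] {R : ℝ}
    (hR0 : 0 ≤ R) (hR : ∀ᵐ x ∂μ, |x| ≤ R) (E : ℝ) (n : ℕ) {v : EuclideanSpace ℝ (Fin 2)}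
    (hv : v ≠ 0) :
    Integrable (fun x : Fin n → ℝ =>
      Real.log ‖Matrix.toEuclideanLin (andersonTransferProd E (padSeq x) n) v‖)
      (Measure.pi fun _ : Fin n => μ) := by
  refine Integrable.of_bound (measurable_log_norm_transferProd_apply E n n v).aestronglyMeasurable
    (n * Real.log (|E| + R + 1) + |Real.log ‖v‖|) ?_
  filter_upwards [ae_pi_abs_le hR n] with x hx
  rw [Real.norm_eq_abs]
  have h := abs_log_norm_transferProd_apply_sub_le hR0 hx E hv (n := n)
  have := abs_sub_abs_le_abs_sub
    (Real.log ‖Matrix.toEuclideanLin (andersonTransferProd E (padSeq x) n) v‖) (Real.log ‖v‖)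
  linarith

/-! ### Continuity in the energy of the finite-volume averages -/

/-- **`E ↦ 𝔼 log ‖M_n^E‖` is continuous** (dominated convergence on the support box).
[cite: BucajEtAl2019, Thm 2.6 (the elementary half: upper semicontinuity of `L`)] -/
theorem continuous_integral_log_norm_transferProd (μ : Measure ℝ) [IsProbabilityMeasure μ] {R : ℝ}
    (hR0 : 0 ≤ R) (hR : ∀ᵐ x ∂μ, |x| ≤ R) (n : ℕ) :
    Continuous fun E : ℝ =>
      ∫ x, Real.log ‖andersonTransferProd E (padSeq x) n‖ ∂(Measure.pi fun _ : Fin n => μ) := by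
  refine continuous_iff_continuousAt.mpr fun E₀ => ?_
  have hbox := ae_pi_abs_le hR n
  have hnear : ∀ᶠ E in 𝓝 E₀, |E| ≤ |E₀| + 1 := by
    have : ∀ᶠ E in 𝓝 E₀, dist E E₀ < 1 := Metric.ball_mem_nhds E₀ one_pos
    filter_upwards [this] with E hE
    rw [Real.dist_eq] at hE
    have := abs_sub_abs_le_abs_sub E E₀
    linarith
  refine continuousAt_of_dominated (bound := fun _ => n * Real.log (|E₀| + 1 + R + 1)) ?_ ?_
    (integrable_const _) ?_
  · exact Eventually.of_forall fun E => (measurable_log_norm_transferProd E n n).aestronglyMeasurable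
  · filter_upwards [hnear] with E hE
    filter_upwards [hbox] with x hx
    rw [Real.norm_eq_abs]
    calc |Real.log ‖andersonTransferProd E (padSeq x) n‖| ≤ n * Real.log (|E| + R + 1) :=
          abs_log_norm_transferProd_le hR0 hx E
      _ ≤ n * Real.log (|E₀| + 1 + R + 1) := by
          gcongr
  · filter_upwards [hbox] with x hx
    have hc := (continuous_andersonTransferProd_energy x n).norm
    refine (Real.continuousAt_log ?_).comp hc.continuousAt
    exact (lt_of_lt_of_le one_pos (one_le_norm_of_det_eq_one _
      (det_andersonTransferProd E₀ (padSeq x) n))).ne'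

/-- `E ↦ n⁻¹ 𝔼 log ‖M_n^E‖` is continuous. [cite: BucajEtAl2019, Thm 2.6 (elementary half)] -/
theorem continuous_andersonLogNormAvg (μ : Measure ℝ) [IsProbabilityMeasure μ] {R : ℝ}
    (hR0 : 0 ≤ R) (hR : ∀ᵐ x ∂μ, |x| ≤ R) (n : ℕ) :
    Continuous fun E : ℝ => andersonLogNormAvg μ E n := by
  unfold andersonLogNormAvg
  exact continuous_const.mul (continuous_integral_log_norm_transferProd μ hR0 hR n)

/-- **Upper semicontinuity of the Lyapunov exponent**: `L(E) < L(E₀) + ε` near `E₀` (an infimum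
of continuous functions). [cite: BucajEtAl2019, Thm 2.6 (elementary half)] -/
theorem andersonLyapunov_lt_add_nhds (μ : Measure ℝ) [IsProbabilityMeasure μ] {R : ℝ}
    (hR0 : 0 ≤ R) (hR : ∀ᵐ x ∂μ, |x| ≤ R) (E₀ : ℝ) {ε : ℝ} (hε : 0 < ε) :
    ∀ᶠ E in 𝓝 E₀, andersonLyapunov μ E < andersonLyapunov μ E₀ + ε := by
  have hlt : andersonLyapunov μ E₀ < andersonLyapunov μ E₀ + ε := by linarith
  unfold andersonLyapunov at hlt
  obtain ⟨j, hj⟩ := exists_lt_of_ciInf_lt hlt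
  have hc := (continuous_andersonLogNormAvg μ hR0 hR (j + 1)).continuousAt (x := E₀)
  have hev : ∀ᶠ E in 𝓝 E₀, andersonLogNormAvg μ E (j + 1) < andersonLyapunov μ E₀ + ε :=
    hc.eventually (gt_mem_nhds hj)
  filter_upwards [hev] with E hE
  exact (andersonLyapunov_le_logNormAvg μ E (Nat.succ_pos j)).trans_lt hE

/-! ### Continuity in energy and vector of `𝔼 log ‖M_n^E v‖` on the unit circle -/

/-- **`(E, v) ↦ 𝔼 log ‖M_n^E v‖` is continuous on `ℝ × 𝕊¹`** (dominated convergence). [folklore] -/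
theorem continuous_integral_log_norm_transferProd_apply (μ : Measure ℝ) [IsProbabilityMeasure μ]
    {R : ℝ} (hR0 : 0 ≤ R) (hR : ∀ᵐ x ∂μ, |x| ≤ R) (n : ℕ) :
    Continuous fun p : ℝ × Metric.sphere (0 : EuclideanSpace ℝ (Fin 2)) 1 =>
      ∫ x, Real.log ‖Matrix.toEuclideanLin (andersonTransferProd p.1 (padSeq x) n) (p.2 : EuclideanSpace ℝ (Fin 2))‖
        ∂(Measure.pi fun _ : Fin n => μ) := by
  refine continuous_iff_continuousAt.mpr fun p₀ => ?_
  have hbox := ae_pi_abs_le hR n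
  have hnear : ∀ᶠ p : ℝ × Metric.sphere (0 : EuclideanSpace ℝ (Fin 2)) 1 in 𝓝 p₀, |p.1| ≤ |p₀.1| + 1 := by
    have h1 : ∀ᶠ E in 𝓝 p₀.1, dist E p₀.1 < 1 := Metric.ball_mem_nhds _ one_pos
    have h2 := continuous_fst.continuousAt.eventually h1
    filter_upwards [h2] with p hp
    rw [Real.dist_eq] at hp
    have := abs_sub_abs_le_abs_sub p.1 p₀.1
    linarith
  have hunit : ∀ w : Metric.sphere (0 : EuclideanSpace ℝ (Fin 2)) 1,
      ‖(w : EuclideanSpace ℝ (Fin 2))‖ = 1 := fun w => by simp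
  refine continuousAt_of_dominated (bound := fun _ => n * Real.log (|p₀.1| + 1 + R + 1)) ?_ ?_
    (integrable_const _) ?_
  · exact Eventually.of_forall fun p =>
      (measurable_log_norm_transferProd_apply p.1 n n _).aestronglyMeasurable
  · filter_upwards [hnear] with p hp
    filter_upwards [hbox] with x hx
    rw [Real.norm_eq_abs]
    calc |Real.log ‖Matrix.toEuclideanLin (andersonTransferProd p.1 (padSeq x) n) (p.2 : EuclideanSpace ℝ (Fin 2))‖|
          ≤ n * Real.log (|p.1| + R + 1) := abs_log_norm_transferProd_apply_le hR0 hx p.1 (hunit p.2)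
      _ ≤ n * Real.log (|p₀.1| + 1 + R + 1) := by
          gcongr
  · filter_upwards [hbox] with x hx
    have hc : Continuous fun p : ℝ × Metric.sphere (0 : EuclideanSpace ℝ (Fin 2)) 1 =>
        Matrix.toEuclideanLin (andersonTransferProd p.1 (padSeq x) n) (p.2 : EuclideanSpace ℝ (Fin 2)) :=
      (continuous_andersonTransferProd_param_apply (n := n) n).comp
        ((continuous_fst.prodMk continuous_const).prodMk (continuous_subtype_val.comp continuous_snd))
    refine (Real.continuousAt_log ?_).comp hc.norm.continuousAt
    have hv0 : (p₀.2 : EuclideanSpace ℝ (Fin 2)) ≠ 0 := by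
      intro h; have := hunit p₀.2; rw [h, norm_zero] at this; exact zero_ne_one this
    exact (norm_pos_iff.mpr (toEuclideanLin_ne_zero_of_det _ (det_andersonTransferProd p₀.1 (padSeq x) n) hv0)).ne'


/-! ### Splitting off one site at the front; blocks -/

/-- **Integrating out the first site**: `∫ F dμ^{⊗(n+1)} = ∫ F(a :: x) d(μ ⊗ μ^{⊗n})(a, x)`. [folklore] -/
theorem integral_pi_succ_eq_integral_prod_cons (μ : Measure ℝ) [SigmaFinite μ] (n : ℕ)
    (F : (Fin (n + 1) → ℝ) → ℝ) :
    ∫ z, F z ∂(Measure.pi fun _ : Fin (n + 1) => μ) =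
      ∫ p, F (Fin.cons p.1 p.2) ∂(μ.prod (Measure.pi fun _ : Fin n => μ)) := by
  have hmp := (measurePreserving_piFinSuccAbove (fun _ : Fin (n + 1) => μ) 0).symm
  rw [← hmp.integral_comp']
  refine integral_congr_ae (Eventually.of_forall fun p => ?_)
  change F (Fin.insertNth 0 p.1 p.2) = F (Fin.cons p.1 p.2)
  rw [Fin.insertNth_zero']

/-- **Cocycle over a sample with one site prepended**: `M_{n+1}(a :: x) = M_n(x) M^E(a)`.
[cite: BucajEtAl2019, §2 (display after eq. (2.1))] -/
theorem andersonTransferProd_cons (E a : ℝ) {n : ℕ} (x : Fin n → ℝ) :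
    andersonTransferProd E (padSeq (Fin.cons a x : Fin (n + 1) → ℝ)) (n + 1) =
      andersonTransferProd E (padSeq x) n * andersonTransfer E a := by
  have h := andersonTransferProd_add E (padSeq (Fin.cons a x : Fin (n + 1) → ℝ)) 1 n
  rw [Nat.add_comm 1 n] at h
  rw [h, andersonTransferProd_succ, andersonTransferProd_zero, mul_one,
    padSeq_of_lt _ (Nat.succ_pos n)]
  congr 1
  · apply andersonTransferProd_congr
    intro k hk
    rw [padSeq_of_lt _ (by omega : 1 + k < n + 1), padSeq_of_lt _ hk]
    have : (⟨1 + k, (by omega : 1 + k < n + 1)⟩ : Fin (n + 1)) = Fin.succ ⟨k, hk⟩ :=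
      Fin.ext (by simp [Nat.add_comm])
    rw [this, Fin.cons_succ]

/-- A.e. on `μ^{⊗p} ⊗ μ^{⊗q}` both blocks lie in the support box. [folklore] -/
theorem ae_prod_pi_abs_le {μ : Measure ℝ} [IsProbabilityMeasure μ] {R : ℝ} (hR : ∀ᵐ x ∂μ, |x| ≤ R)
    (p q : ℕ) :
    ∀ᵐ w ∂((Measure.pi fun _ : Fin p => μ).prod (Measure.pi fun _ : Fin q => μ)),
      (∀ i, |w.1 i| ≤ R) ∧ ∀ j, |w.2 j| ≤ R :=
  (Measure.quasiMeasurePreserving_fst.ae (ae_pi_abs_le hR p)).and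
    (Measure.quasiMeasurePreserving_snd.ae (ae_pi_abs_le hR q))

/-- A.e. on `μ ⊗ μ^{⊗n}` the site and the block lie in the support box. [folklore] -/
theorem ae_prod_cons_abs_le {μ : Measure ℝ} [IsProbabilityMeasure μ] {R : ℝ} (hR : ∀ᵐ x ∂μ, |x| ≤ R)
    (n : ℕ) :
    ∀ᵐ w ∂(μ.prod (Measure.pi fun _ : Fin n => μ)), |w.1| ≤ R ∧ ∀ j, |w.2 j| ≤ R :=
  (Measure.quasiMeasurePreserving_fst.ae hR).and (Measure.quasiMeasurePreserving_snd.ae (ae_pi_abs_le hR n))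

/-- The box for a prepended sample. [folklore] -/
theorem abs_cons_le {n : ℕ} {a : ℝ} {x : Fin n → ℝ} {R : ℝ} (ha : |a| ≤ R) (hx : ∀ j, |x j| ≤ R) :
    ∀ i, |(Fin.cons a x : Fin (n + 1) → ℝ) i| ≤ R := by
  intro i
  refine Fin.cases ?_ (fun j => ?_) i
  · simpa using ha
  · simpa using hx j

/-- The box for an appended sample. [folklore] -/
theorem abs_append_le {p q : ℕ} {x : Fin p → ℝ} {y : Fin q → ℝ} {R : ℝ} (hx : ∀ i, |x i| ≤ R)
    (hy : ∀ j, |y j| ≤ R) : ∀ i, |Fin.append x y i| ≤ R := by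
  intro i
  induction i using Fin.addCases with
  | left j => simpa using hx j
  | right j => simpa using hy j

/-! ### Homogeneity in the vector -/

/-- `log ‖X (c • u)‖ = log c + log ‖X u‖` for `c > 0`, `X u ≠ 0`. [folklore] -/
theorem log_norm_toEuclideanLin_smul (X : Matrix (Fin 2) (Fin 2) ℝ) {c : ℝ} (hc : 0 < c)
    {u : EuclideanSpace ℝ (Fin 2)} (hu : Matrix.toEuclideanLin X u ≠ 0) :
    Real.log ‖Matrix.toEuclideanLin X (c • u)‖ = Real.log c + Real.log ‖Matrix.toEuclideanLin X u‖ := by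
  rw [map_smul, norm_smul, Real.norm_eq_abs, abs_of_pos hc,
    Real.log_mul hc.ne' (norm_ne_zero_iff.mpr hu)]

/-- **Homogeneity of `𝔼 log ‖M_n u‖`**: for `u ≠ 0`,
`𝔼 log ‖M_n u‖ = log ‖u‖ + 𝔼 log ‖M_n (u/‖u‖)‖`. [folklore] -/
theorem integral_log_norm_transferProd_apply_eq_add_unit (μ : Measure ℝ) [IsProbabilityMeasure μ]
    {R : ℝ} (hR0 : 0 ≤ R) (hR : ∀ᵐ x ∂μ, |x| ≤ R) (E : ℝ) (n : ℕ) {u : EuclideanSpace ℝ (Fin 2)}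
    (hu : u ≠ 0) :
    ∫ x, Real.log ‖Matrix.toEuclideanLin (andersonTransferProd E (padSeq x) n) u‖
        ∂(Measure.pi fun _ : Fin n => μ) =
      Real.log ‖u‖ + ∫ x, Real.log ‖Matrix.toEuclideanLin (andersonTransferProd E (padSeq x) n) (‖u‖⁻¹ • u)‖
        ∂(Measure.pi fun _ : Fin n => μ) := by
  have hupos : 0 < ‖u‖ := norm_pos_iff.mpr hu
  have hunit : ‖(‖u‖⁻¹ • u)‖ = 1 := norm_smul_inv_norm hu
  have hu' : ‖u‖⁻¹ • u ≠ 0 := by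
    intro h; rw [h, norm_zero] at hunit; exact zero_ne_one hunit
  have hpt : ∀ x : Fin n → ℝ,
      Real.log ‖Matrix.toEuclideanLin (andersonTransferProd E (padSeq x) n) u‖ =
        Real.log ‖u‖ + Real.log ‖Matrix.toEuclideanLin (andersonTransferProd E (padSeq x) n) (‖u‖⁻¹ • u)‖ := by
    intro x
    have h1 : u = ‖u‖ • (‖u‖⁻¹ • u) := by
      rw [smul_smul, mul_inv_cancel₀ hupos.ne', one_smul]
    conv_lhs => rw [h1]
    exact log_norm_toEuclideanLin_smul _ hupos
      (toEuclideanLin_ne_zero_of_det _ (det_andersonTransferProd E _ n) hu')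
  simp_rw [hpt]
  rw [integral_add (integrable_const _) (integrable_log_norm_transferProd_apply μ hR0 hR E n hu'),
    integral_const, smul_eq_mul]
  simp

/-! ### Sub-additivity of `𝔼 log ‖M_n‖` and super-additivity of `inf_v 𝔼 log ‖M_n v‖` -/

/-- **Sub-additivity**: `𝔼 log ‖M_{p+q}‖ ≤ 𝔼 log ‖M_p‖ + 𝔼 log ‖M_q‖`.
[cite: BucajEtAl2019, §2 (definition of `L`: the limit exists and equals the infimum by subadditivity)] -/
theorem integral_log_norm_transferProd_add_le (μ : Measure ℝ) [IsProbabilityMeasure μ] {R : ℝ}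
    (hR0 : 0 ≤ R) (hR : ∀ᵐ x ∂μ, |x| ≤ R) (E : ℝ) (p q : ℕ) :
    ∫ z, Real.log ‖andersonTransferProd E (padSeq z) (p + q)‖ ∂(Measure.pi fun _ : Fin (p + q) => μ) ≤
      (∫ x, Real.log ‖andersonTransferProd E (padSeq x) p‖ ∂(Measure.pi fun _ : Fin p => μ)) +
        ∫ y, Real.log ‖andersonTransferProd E (padSeq y) q‖ ∂(Measure.pi fun _ : Fin q => μ) := by
  rw [integral_pi_fin_add_eq_integral_prod μ p q (measurable_log_norm_transferProd E (p + q) (p + q))]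
  have hsplit : ∀ w : (Fin p → ℝ) × (Fin q → ℝ),
      Real.log ‖andersonTransferProd E (padSeq (Fin.append w.1 w.2)) (p + q)‖ =
        Real.log ‖andersonTransferProd E (padSeq w.2) q * andersonTransferProd E (padSeq w.1) p‖ :=
    fun w => by rw [andersonTransferProd_append E w.1 w.2]
  simp_rw [hsplit]
  have hpt : ∀ w : (Fin p → ℝ) × (Fin q → ℝ),
      Real.log ‖andersonTransferProd E (padSeq w.2) q * andersonTransferProd E (padSeq w.1) p‖ ≤
        Real.log ‖andersonTransferProd E (padSeq w.1) p‖ +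
          Real.log ‖andersonTransferProd E (padSeq w.2) q‖ := by
    intro w
    have hA := one_le_norm_of_det_eq_one _ (det_andersonTransferProd E (padSeq w.1) p)
    have hB := one_le_norm_of_det_eq_one _ (det_andersonTransferProd E (padSeq w.2) q)
    have hBA := one_le_norm_of_det_eq_one
      (andersonTransferProd E (padSeq w.2) q * andersonTransferProd E (padSeq w.1) p)
      (by rw [Matrix.det_mul, det_andersonTransferProd, det_andersonTransferProd, mul_one])
    calc Real.log ‖andersonTransferProd E (padSeq w.2) q * andersonTransferProd E (padSeq w.1) p‖
        ≤ Real.log (‖andersonTransferProd E (padSeq w.2) q‖ * ‖andersonTransferProd E (padSeq w.1) p‖) :=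
          Real.log_le_log (by positivity) (Matrix.l2_opNorm_mul _ _)
      _ = Real.log ‖andersonTransferProd E (padSeq w.1) p‖ +
            Real.log ‖andersonTransferProd E (padSeq w.2) q‖ := by
          rw [Real.log_mul (by positivity) (by positivity), add_comm]
  have hI1 : Integrable (fun w : (Fin p → ℝ) × (Fin q → ℝ) =>
      Real.log ‖andersonTransferProd E (padSeq w.1) p‖)
      ((Measure.pi fun _ : Fin p => μ).prod (Measure.pi fun _ : Fin q => μ)) :=
    (integrable_log_norm_transferProd μ hR0 hR E p).comp_fst _
  have hI2 : Integrable (fun w : (Fin p → ℝ) × (Fin q → ℝ) =>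
      Real.log ‖andersonTransferProd E (padSeq w.2) q‖)
      ((Measure.pi fun _ : Fin p => μ).prod (Measure.pi fun _ : Fin q => μ)) :=
    (integrable_log_norm_transferProd μ hR0 hR E q).comp_snd _
  have hI : Integrable (fun w : (Fin p → ℝ) × (Fin q → ℝ) =>
      Real.log ‖andersonTransferProd E (padSeq w.2) q * andersonTransferProd E (padSeq w.1) p‖)
      ((Measure.pi fun _ : Fin p => μ).prod (Measure.pi fun _ : Fin q => μ)) := by
    refine Integrable.mono' (hI1.add hI2) ?_ (Eventually.of_forall fun w => ?_)
    · have hm : Measurable fun w : (Fin p → ℝ) × (Fin q → ℝ) =>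
          Real.log ‖andersonTransferProd E (padSeq (Fin.append w.1 w.2)) (p + q)‖ :=
        (measurable_log_norm_transferProd E (p + q) (p + q)).comp (measurable_finAppend p q)
      have : (fun w : (Fin p → ℝ) × (Fin q → ℝ) =>
          Real.log ‖andersonTransferProd E (padSeq w.2) q * andersonTransferProd E (padSeq w.1) p‖) =
          fun w => Real.log ‖andersonTransferProd E (padSeq (Fin.append w.1 w.2)) (p + q)‖ :=
        funext fun w => (hsplit w).symm
      rw [this]
      exact hm.aestronglyMeasurable
    · rw [Real.norm_eq_abs, abs_of_nonneg]
      · exact hpt w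
      · exact Real.log_nonneg (one_le_norm_of_det_eq_one _
          (by rw [Matrix.det_mul, det_andersonTransferProd, det_andersonTransferProd, mul_one]))
  calc _ ≤ ∫ w, (Real.log ‖andersonTransferProd E (padSeq w.1) p‖ +
          Real.log ‖andersonTransferProd E (padSeq w.2) q‖)
          ∂((Measure.pi fun _ : Fin p => μ).prod (Measure.pi fun _ : Fin q => μ)) :=
        integral_mono hI (hI1.add hI2) hpt
    _ = _ := by
        rw [integral_add hI1 hI2]
        congr 1
        · have h := integral_fun_fst (μ := Measure.pi fun _ : Fin p => μ) (ν := Measure.pi fun _ : Fin q => μ)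
            (fun x : Fin p → ℝ => Real.log ‖andersonTransferProd E (padSeq x) p‖)
          simp only [probReal_univ, one_smul] at h
          exact h
        · have h := integral_fun_snd (μ := Measure.pi fun _ : Fin p => μ) (ν := Measure.pi fun _ : Fin q => μ)
            (fun y : Fin q → ℝ => Real.log ‖andersonTransferProd E (padSeq y) q‖)
          simp only [probReal_univ, one_smul] at h
          exact h

/-- `|𝔼 log ‖M_n^E v‖| ≤ n log(|E|+R+1)` for a unit vector. [folklore] -/
theorem abs_integral_log_norm_transferProd_apply_le (μ : Measure ℝ) [IsProbabilityMeasure μ]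
    {R : ℝ} (hR0 : 0 ≤ R) (hR : ∀ᵐ x ∂μ, |x| ≤ R) (E : ℝ) (n : ℕ) {v : EuclideanSpace ℝ (Fin 2)}
    (hv : ‖v‖ = 1) :
    |∫ x, Real.log ‖Matrix.toEuclideanLin (andersonTransferProd E (padSeq x) n) v‖
        ∂(Measure.pi fun _ : Fin n => μ)| ≤ n * Real.log (|E| + R + 1) := by
  have h := norm_integral_le_of_norm_le_const (μ := Measure.pi fun _ : Fin n => μ)
    (f := fun x : Fin n → ℝ => Real.log ‖Matrix.toEuclideanLin (andersonTransferProd E (padSeq x) n) v‖)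
    (C := n * Real.log (|E| + R + 1)) ?_
  · simpa [Real.norm_eq_abs] using h
  · filter_upwards [ae_pi_abs_le hR n] with x hx
    rw [Real.norm_eq_abs]
    exact abs_log_norm_transferProd_apply_le hR0 hx E hv

/-- `|𝔼 log ‖M_n^E‖| ≤ n log(|E|+R+1)`. [folklore] -/
theorem abs_integral_log_norm_transferProd_le (μ : Measure ℝ) [IsProbabilityMeasure μ]
    {R : ℝ} (hR0 : 0 ≤ R) (hR : ∀ᵐ x ∂μ, |x| ≤ R) (E : ℝ) (n : ℕ) :
    |∫ x, Real.log ‖andersonTransferProd E (padSeq x) n‖ ∂(Measure.pi fun _ : Fin n => μ)| ≤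
      n * Real.log (|E| + R + 1) := by
  have h := norm_integral_le_of_norm_le_const (μ := Measure.pi fun _ : Fin n => μ)
    (f := fun x : Fin n → ℝ => Real.log ‖andersonTransferProd E (padSeq x) n‖)
    (C := n * Real.log (|E| + R + 1)) ?_
  · simpa [Real.norm_eq_abs] using h
  · filter_upwards [ae_pi_abs_le hR n] with x hx
    rw [Real.norm_eq_abs]
    exact abs_log_norm_transferProd_le hR0 hx E

/-- `𝔼 log ‖M_n v‖ ≤ 𝔼 log ‖M_n‖` for a unit vector `v`. [folklore] -/
theorem integral_log_norm_transferProd_apply_le (μ : Measure ℝ) [IsProbabilityMeasure μ]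
    {R : ℝ} (hR0 : 0 ≤ R) (hR : ∀ᵐ x ∂μ, |x| ≤ R) (E : ℝ) (n : ℕ) {v : EuclideanSpace ℝ (Fin 2)}
    (hv : ‖v‖ = 1) :
    ∫ x, Real.log ‖Matrix.toEuclideanLin (andersonTransferProd E (padSeq x) n) v‖
        ∂(Measure.pi fun _ : Fin n => μ) ≤
      ∫ x, Real.log ‖andersonTransferProd E (padSeq x) n‖ ∂(Measure.pi fun _ : Fin n => μ) := by
  have hv0 : v ≠ 0 := by
    intro h; rw [h, norm_zero] at hv; exact zero_ne_one hv
  refine integral_mono (integrable_log_norm_transferProd_apply μ hR0 hR E n hv0)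
    (integrable_log_norm_transferProd μ hR0 hR E n) fun x => ?_
  have hpos := norm_pos_iff.mpr (toEuclideanLin_ne_zero_of_det _ (det_andersonTransferProd E (padSeq x) n) hv0)
  refine Real.log_le_log hpos ?_
  simpa [hv] using norm_toEuclideanLin_apply_le (andersonTransferProd E (padSeq x) n) v

/-- **Super-additivity of `inf_v 𝔼 log ‖M_n v‖`** (independence of the blocks and homogeneity):
`𝔼 log ‖M_p v‖ + inf_w 𝔼 log ‖M_q w‖ ≤ 𝔼 log ‖M_{p+q} v‖` for every unit `v`.
[cite: BucajEtAl2019, §3 (proof of Prop. 3.6, the cocycle/independence step)] -/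
theorem integral_log_norm_transferProd_apply_add_ge (μ : Measure ℝ) [IsProbabilityMeasure μ]
    {R : ℝ} (hR0 : 0 ≤ R) (hR : ∀ᵐ x ∂μ, |x| ≤ R) (E : ℝ) (p q : ℕ) {v : EuclideanSpace ℝ (Fin 2)}
    (hv : ‖v‖ = 1) :
    (∫ x, Real.log ‖Matrix.toEuclideanLin (andersonTransferProd E (padSeq x) p) v‖
        ∂(Measure.pi fun _ : Fin p => μ)) +
      (⨅ w : Metric.sphere (0 : EuclideanSpace ℝ (Fin 2)) 1,
        ∫ y, Real.log ‖Matrix.toEuclideanLin (andersonTransferProd E (padSeq y) q)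
          (w : EuclideanSpace ℝ (Fin 2))‖ ∂(Measure.pi fun _ : Fin q => μ)) ≤
    ∫ z, Real.log ‖Matrix.toEuclideanLin (andersonTransferProd E (padSeq z) (p + q)) v‖
        ∂(Measure.pi fun _ : Fin (p + q) => μ) := by
  set B : ℝ := ⨅ w : Metric.sphere (0 : EuclideanSpace ℝ (Fin 2)) 1,
        ∫ y, Real.log ‖Matrix.toEuclideanLin (andersonTransferProd E (padSeq y) q)
          (w : EuclideanSpace ℝ (Fin 2))‖ ∂(Measure.pi fun _ : Fin q => μ) with hB
  have hv0 : v ≠ 0 := by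
    intro h; rw [h, norm_zero] at hv; exact zero_ne_one hv
  have hC : 0 ≤ Real.log (|E| + R + 1) := Real.log_nonneg (by linarith [abs_nonneg E])
  -- lower bound for the infimum family
  have hbdd : BddBelow (Set.range fun w : Metric.sphere (0 : EuclideanSpace ℝ (Fin 2)) 1 =>
      ∫ y, Real.log ‖Matrix.toEuclideanLin (andersonTransferProd E (padSeq y) q)
        (w : EuclideanSpace ℝ (Fin 2))‖ ∂(Measure.pi fun _ : Fin q => μ)) := by
    refine ⟨-(q * Real.log (|E| + R + 1)), ?_⟩
    rintro _ ⟨w, rfl⟩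
    have hw : ‖(w : EuclideanSpace ℝ (Fin 2))‖ = 1 := by simp
    exact (abs_le.mp (abs_integral_log_norm_transferProd_apply_le μ hR0 hR E q hw)).1
  -- split the sample
  rw [integral_pi_fin_add_eq_integral_prod μ p q (measurable_log_norm_transferProd_apply E (p + q) (p + q) v)]
  have hsplit : ∀ w : (Fin p → ℝ) × (Fin q → ℝ),
      Real.log ‖Matrix.toEuclideanLin (andersonTransferProd E (padSeq (Fin.append w.1 w.2)) (p + q)) v‖ =
        Real.log ‖Matrix.toEuclideanLin (andersonTransferProd E (padSeq w.2) q)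
          (Matrix.toEuclideanLin (andersonTransferProd E (padSeq w.1) p) v)‖ := by
    intro w
    rw [andersonTransferProd_append E w.1 w.2, toEuclideanLin_mul_apply]
  simp_rw [hsplit]
  -- integrability of the split integrand
  have hmeas : Measurable fun w : (Fin p → ℝ) × (Fin q → ℝ) =>
      Real.log ‖Matrix.toEuclideanLin (andersonTransferProd E (padSeq w.2) q)
        (Matrix.toEuclideanLin (andersonTransferProd E (padSeq w.1) p) v)‖ := by
    have : (fun w : (Fin p → ℝ) × (Fin q → ℝ) =>
        Real.log ‖Matrix.toEuclideanLin (andersonTransferProd E (padSeq w.2) q)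
          (Matrix.toEuclideanLin (andersonTransferProd E (padSeq w.1) p) v)‖) =
        fun w => Real.log ‖Matrix.toEuclideanLin
          (andersonTransferProd E (padSeq (Fin.append w.1 w.2)) (p + q)) v‖ :=
      funext fun w => (hsplit w).symm
    rw [this]
    exact (measurable_log_norm_transferProd_apply E (p + q) (p + q) v).comp (measurable_finAppend p q)
  have hI : Integrable (fun w : (Fin p → ℝ) × (Fin q → ℝ) =>
      Real.log ‖Matrix.toEuclideanLin (andersonTransferProd E (padSeq w.2) q)
        (Matrix.toEuclideanLin (andersonTransferProd E (padSeq w.1) p) v)‖)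
      ((Measure.pi fun _ : Fin p => μ).prod (Measure.pi fun _ : Fin q => μ)) := by
    refine Integrable.of_bound hmeas.aestronglyMeasurable ((p + q : ℕ) * Real.log (|E| + R + 1)) ?_
    filter_upwards [ae_prod_pi_abs_le hR p q] with w hw
    rw [Real.norm_eq_abs, ← hsplit w]
    exact abs_log_norm_transferProd_apply_le hR0 (abs_append_le hw.1 hw.2) E hv
  rw [integral_prod _ hI]
  -- pointwise lower bound for the inner integral
  have hinner : ∀ x : Fin p → ℝ,
      Real.log ‖Matrix.toEuclideanLin (andersonTransferProd E (padSeq x) p) v‖ + B ≤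
        ∫ y, Real.log ‖Matrix.toEuclideanLin (andersonTransferProd E (padSeq y) q)
          (Matrix.toEuclideanLin (andersonTransferProd E (padSeq x) p) v)‖ ∂(Measure.pi fun _ : Fin q => μ) := by
    intro x
    set u := Matrix.toEuclideanLin (andersonTransferProd E (padSeq x) p) v with hu
    have hu0 : u ≠ 0 := toEuclideanLin_ne_zero_of_det _ (det_andersonTransferProd E _ p) hv0
    have hunit : ‖(‖u‖⁻¹ • u)‖ = 1 := norm_smul_inv_norm hu0
    rw [integral_log_norm_transferProd_apply_eq_add_unit μ hR0 hR E q hu0]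
    gcongr
    exact ciInf_le hbdd ⟨‖u‖⁻¹ • u, by simpa using hunit⟩
  have hIl : Integrable (fun x : Fin p → ℝ =>
      Real.log ‖Matrix.toEuclideanLin (andersonTransferProd E (padSeq x) p) v‖ + B)
      (Measure.pi fun _ : Fin p => μ) :=
    (integrable_log_norm_transferProd_apply μ hR0 hR E p hv0).add (integrable_const _)
  calc (∫ x, Real.log ‖Matrix.toEuclideanLin (andersonTransferProd E (padSeq x) p) v‖
        ∂(Measure.pi fun _ : Fin p => μ)) + B
      = ∫ x, (Real.log ‖Matrix.toEuclideanLin (andersonTransferProd E (padSeq x) p) v‖ + B)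
        ∂(Measure.pi fun _ : Fin p => μ) := by
        rw [integral_add (integrable_log_norm_transferProd_apply μ hR0 hR E p hv0) (integrable_const _),
          integral_const, smul_eq_mul]
        simp
    _ ≤ _ := integral_mono hIl hI.integral_prod_left hinner

/-- From sub-additivity of `a`, super-additivity of `b` and `b ≤ a`: `b(n)/n ≤ a(j+1)/(j+1)`
(pure arithmetic of sequences; used with `a(n) = 𝔼 log ‖M_n‖`, `b(n) = inf_v 𝔼 log ‖M_n v‖`). [folklore] -/
theorem div_le_div_of_subadditive_superadditive {a b : ℕ → ℝ} (ha : ∀ m n, a (m + n) ≤ a m + a n)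
    (hb : ∀ m n, b m + b n ≤ b (m + n)) (hab : ∀ n, b n ≤ a n) {n : ℕ} (hn : 1 ≤ n) (j : ℕ) :
    b n / n ≤ a (j + 1) / (j + 1) := by
  have hak : ∀ k p : ℕ, a ((k + 1) * p) ≤ (k + 1) * a p := by
    intro k p
    induction k with
    | zero => simp
    | succ k ih =>
      rw [Nat.succ_mul]
      calc a ((k + 1) * p + p) ≤ a ((k + 1) * p) + a p := ha _ _
        _ ≤ (k + 1) * a p + a p := by gcongr
        _ = ((k + 1 : ℕ) + 1 : ℝ) * a p := by push_cast; ring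
  have hbk : ∀ k p : ℕ, (k + 1) * b p ≤ b ((k + 1) * p) := by
    intro k p
    induction k with
    | zero => simp
    | succ k ih =>
      rw [Nat.succ_mul]
      calc ((k + 1 : ℕ) + 1 : ℝ) * b p = (k + 1) * b p + b p := by push_cast; ring
        _ ≤ b ((k + 1) * p) + b p := by gcongr
        _ ≤ b ((k + 1) * p + p) := hb _ _
  obtain ⟨m, rfl⟩ : ∃ m, n = m + 1 := ⟨n - 1, by omega⟩
  have h1 : ((j : ℝ) + 1) * b (m + 1) ≤ b ((j + 1) * (m + 1)) := by exact_mod_cast hbk j (m + 1)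
  have h2 : b ((j + 1) * (m + 1)) ≤ a ((j + 1) * (m + 1)) := hab _
  have h3 : a ((m + 1) * (j + 1)) ≤ ((m : ℝ) + 1) * a (j + 1) := by exact_mod_cast hak m (j + 1)
  rw [Nat.mul_comm] at h3
  rw [div_le_div_iff₀ (by positivity) (by positivity)]
  push_cast
  nlinarith [h1, h2, h3]

/-- **`inf_{‖v‖=1} 𝔼 log ‖M_n^E v‖ ≤ n L(E)`** for every `n ≥ 1`: the lower uniform growth rate of
vectors never exceeds the Lyapunov exponent (super-additivity of the vector averages against
sub-additivity of the matrix averages). [cite: BucajEtAl2019, §2–3 (`L` as an infimum; cocycle property)] -/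
theorem iInf_integral_log_norm_apply_div_le_andersonLyapunov (μ : Measure ℝ) [IsProbabilityMeasure μ]
    {R : ℝ} (hR0 : 0 ≤ R) (hR : ∀ᵐ x ∂μ, |x| ≤ R) (E : ℝ) {n : ℕ} (hn : 1 ≤ n) :
    (⨅ w : Metric.sphere (0 : EuclideanSpace ℝ (Fin 2)) 1,
        ∫ y, Real.log ‖Matrix.toEuclideanLin (andersonTransferProd E (padSeq y) n)
          (w : EuclideanSpace ℝ (Fin 2))‖ ∂(Measure.pi fun _ : Fin n => μ)) / n ≤
      andersonLyapunov μ E := by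
  set a : ℕ → ℝ := fun N =>
    ∫ x, Real.log ‖andersonTransferProd E (padSeq x) N‖ ∂(Measure.pi fun _ : Fin N => μ) with ha
  set b : ℕ → ℝ := fun N => ⨅ w : Metric.sphere (0 : EuclideanSpace ℝ (Fin 2)) 1,
        ∫ y, Real.log ‖Matrix.toEuclideanLin (andersonTransferProd E (padSeq y) N)
          (w : EuclideanSpace ℝ (Fin 2))‖ ∂(Measure.pi fun _ : Fin N => μ) with hb
  have hbdd : ∀ N, BddBelow (Set.range fun w : Metric.sphere (0 : EuclideanSpace ℝ (Fin 2)) 1 =>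
      ∫ y, Real.log ‖Matrix.toEuclideanLin (andersonTransferProd E (padSeq y) N)
        (w : EuclideanSpace ℝ (Fin 2))‖ ∂(Measure.pi fun _ : Fin N => μ)) := by
    intro N
    refine ⟨-(N * Real.log (|E| + R + 1)), ?_⟩
    rintro _ ⟨w, rfl⟩
    have hw : ‖(w : EuclideanSpace ℝ (Fin 2))‖ = 1 := by simp
    exact (abs_le.mp (abs_integral_log_norm_transferProd_apply_le μ hR0 hR E N hw)).1
  let w₀ : Metric.sphere (0 : EuclideanSpace ℝ (Fin 2)) 1 :=
    ⟨EuclideanSpace.single 0 1, by simp⟩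
  haveI : Nonempty (Metric.sphere (0 : EuclideanSpace ℝ (Fin 2)) 1) := ⟨w₀⟩
  have hsub : ∀ m k, a (m + k) ≤ a m + a k := fun m k =>
    integral_log_norm_transferProd_add_le μ hR0 hR E m k
  have hsup : ∀ m k, b m + b k ≤ b (m + k) := by
    intro m k
    refine le_ciInf fun w => ?_
    have hw : ‖(w : EuclideanSpace ℝ (Fin 2))‖ = 1 := by simp
    calc b m + b k ≤ (∫ x, Real.log ‖Matrix.toEuclideanLin (andersonTransferProd E (padSeq x) m)
          (w : EuclideanSpace ℝ (Fin 2))‖ ∂(Measure.pi fun _ : Fin m => μ)) + b k :=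
          add_le_add_left (ciInf_le (hbdd m) w) _
      _ ≤ _ := integral_log_norm_transferProd_apply_add_ge μ hR0 hR E m k hw
  have hab : ∀ N, b N ≤ a N := by
    intro N
    have hw : ‖(w₀ : EuclideanSpace ℝ (Fin 2))‖ = 1 := by simp [w₀]
    exact (ciInf_le (hbdd N) w₀).trans (integral_log_norm_transferProd_apply_le μ hR0 hR E N hw)
  show b n / n ≤ andersonLyapunov μ E
  unfold andersonLyapunov
  refine le_ciInf fun j => ?_
  have h := div_le_div_of_subadditive_superadditive hsub hsup hab hn j
  unfold andersonLogNormAvg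
  rw [one_div_mul_eq_div]
  exact_mod_cast h

end Literature.Probability.RandomMatrixProducts

end
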